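import Summits.AtomisticToContinuum.FouriersLaw.Theorems.HonestZwanzigRobinCoercivityOhmBulk
import Summits.AtomisticToContinuum.FouriersLaw.Theorems.HonestZwanzigRobinCoercivitySymbolZeroOfPositiveMemory
import Summits.AtomisticToContinuum.FouriersLaw.Theorems.HonestZwanzigRobinCoercivityOhmOfBlockInputsAux

/-!
# `HonestZwanzig.RobinCoercivity`, line `limit-operator-memory-form`: the block inputs imply `PositiveMemory`

Support file for the crux `stmt-AtomisticToContinuum-12695` (`RobinCoercivity` of route `HonestZwanzig`, sub-problem
`FouriersLaw`), line `limit-operator-memory-form`, registered LINK theorem `positiveMemory_of_blockInputs`: the line's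
shared rank-2 inputs (U′) `BlockBandDomination` (uniform off-band `ℓ¹` row tails `τ(d) → 0` of the block memory matrix
`W_N(s)`) and (L) `BlockBulkLimit` (summable bulk Toeplitz limit `K_∞` of `W_N(s)` at every fixed distance), together
with the residue (Q1) `BulkSymbolPositivity` used ONLY at `θ = 0` (`Σ'_z K_∞(z) > 0`), imply the route's rank-3 crux
`PositiveMemory` (stmt-AtomisticToContinuum-12694) AS TYPED: every limit `ρ_b` of the orthogonal DC response
`schur_s(j_b, J)` along `s ↓ 0` at a bulk bond `b` is `≥ k₀ := Σ'_z K_∞(z) / 2 > 0`, uniformly in `N`.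

Proof. Put `κ = Σ'_z K_∞(z)`; (Q1) at `θ = 0` for the bulk limit `K_∞` of (L) gives `κ > 0`. Choose the window `Z`
with `|Σ_{|z| ≤ Z} K_∞(z) − κ| < κ/6` (`tendsto_sum_Icc_symm`) and `τ(Z) < κ/6`, then the bulk depth `R_L` of (L) at
accuracy `κ/(6(2Z+1))` and distance `Z`, and put `R = R_L + Z`. For a bond `b` at distance `≥ R` from both ends the
position `i = b + 1` is at distance `> R_L + Z` from both contacts, so for all small `s > 0` the bond-column row sum
`Σ_{bond j} W_N(s)_{ij} = schur_s(j_b, J)` (`bulk_row_sum_pkg`) is within `(2Z+1)·κ/(6(2Z+1)) + τ(Z) ≤ κ/3` of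
`Σ_{|z| ≤ Z} K_∞(z) ≥ κ − κ/6` (`ohm_row_abs_le`: window columns are `R_L`-bulk and close to `K_∞`, off-window columns
are absorbed by the band tail), whence `schur_s(j_b, J) ≥ κ/2` on a right-neighbourhood of `s = 0`; any limit `ρ_b`
along `𝓝[>] 0` inherits the bound (`ge_of_tendsto`) — existence of the limit is never needed.
-/

noncomputable section

open MeasureTheory Finset Matrix Filter Topology
open Literature.MathematicalPhysics.KineticTheory.HeatConduction
open Summit.AtomisticToContinuum.FouriersLaw.Theses.HonestZwanzig
open Summit.AtomisticToContinuum.FouriersLaw.Theorems.HonestZwanzig.NetworkReduction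

namespace Summit.AtomisticToContinuum.FouriersLaw.Theorems.HonestZwanzig.Robin

/-! ### The bond row at fixed `N`, canonical objects: a lower bound for every limit -/

/-- **Lower bound for the bond-row limits at fixed `N`, canonical objects.** For `pinnedChain ω₂ lam β γ` (all `> 0`),
`T > 0`, `N ≥ 2` and the line's gadgets `lap, e, G, schur, g, W` with their defining equations: if for `0 < s < s₀` the
rows of `W_N(s)` have off-band tails `Σ_{|i−j| > d}|W_{ij}| ≤ τ(d)` and the `R`-bulk entries at mutual distance `≤ Z` are
`ε`-close to `K(i − j)`, then at a bond `b = i − 1` with `i` at distance `> R + Z` from both contacts EVERY limit `ρ` of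
the orthogonal DC response `schur_s(j_b, J)` along `s ↓ 0` satisfies `Σ_{|z| ≤ Z} K(z) − ((2Z+1)ε + τ(Z)) ≤ ρ`. -/
theorem pm_bulk_row_lower {ω₂ lam β γ T : ℝ} (hω : 0 < ω₂) (hl : 0 < lam) (hβ : 0 < β) (hγ : 0 < γ) (hT : 0 < T)
    {N : ℕ} (hN : 2 ≤ N)
    (lap : ℝ → (PhaseSpace N → ℝ) → (PhaseSpace N → ℝ) → ℝ) (e : Fin N → PhaseSpace N → ℝ)
    (G : ℝ → Matrix (Fin N) (Fin N) ℝ) (schur : ℝ → (PhaseSpace N → ℝ) → (PhaseSpace N → ℝ) → ℝ)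
    (g : Fin (N + 1) → PhaseSpace N → ℝ) (W : ℝ → Fin (N + 1) → Fin (N + 1) → ℝ)
    (hlap : ∀ s f₁ f₂, lap s f₁ f₂ = ∫ t in Set.Ioi (0 : ℝ), Real.exp (-(s * t)) *
      ((∫ z, f₁ z * (∫ y, f₂ y ∂((pinnedChain ω₂ lam β γ).transitionKernel N T T t.toNNReal z))
          ∂(pinnedChain ω₂ lam β γ).gibbsMeasure N T) -
        (∫ z, f₁ z ∂(pinnedChain ω₂ lam β γ).gibbsMeasure N T) *
          (∫ z, f₂ z ∂(pinnedChain ω₂ lam β γ).gibbsMeasure N T)))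
    (he : ∀ x z, e x z = z.2 x ^ 2 / 2 + (pinnedChain ω₂ lam β γ).U (z.1 x) +
      ∑ j : Fin N, ((if j.val = x.val + 1 then (pinnedChain ω₂ lam β γ).V (z.1 j - z.1 x) / 2 else 0) +
        (if x.val = j.val + 1 then (pinnedChain ω₂ lam β γ).V (z.1 x - z.1 j) / 2 else 0)))
    (hG : ∀ s, G s = Matrix.of fun x y => lap s (e x) (e y))
    (hschur : ∀ s f₁ f₂, schur s f₁ f₂ = lap s f₁ f₂ - ∑ x, ∑ y, lap s f₁ (e x) * (G s)⁻¹ x y * lap s (e y) f₂)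
    (hg : ∀ i z, g i z = (∑ b : Fin N, if b.val + 1 = i.val then (pinnedChain ω₂ lam β γ).bondCurrent N b z else 0) +
      (∑ x : Fin N, if (i.val = 0 ∧ x.val = 0) ∨ (i.val = N ∧ x.val + 1 = N) then
        (pinnedChain ω₂ lam β γ).γ * (T - z.2 x ^ 2) else 0))
    (hW : ∀ s i j, W s i j = (if i = j ∧ (i.val = 0 ∨ i.val = N) then (pinnedChain ω₂ lam β γ).γ * T ^ 2 else 0) -
      schur s (fun z => g i (z.1, -z.2)) (g j))
    (K : ℤ → ℝ) (ε s₀ : ℝ) (hs₀ : 0 < s₀) (τ : ℕ → ℝ) (Z R : ℕ) (i : Fin (N + 1)) (b : Fin N)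
    (hib : b.val + 1 = i.val) (hi1 : R + 1 + Z ≤ i.val) (hi2 : i.val + 1 + R + Z ≤ N)
    (hBi : ∀ s : ℝ, 0 < s → s < s₀ → ∀ (i : Fin (N + 1)) (d : ℕ),
      ∑ j : Fin (N + 1), (if (d : ℝ) < |(i.val : ℝ) - j.val| then |W s i j| else 0) ≤ τ d)
    (hLi : ∀ s : ℝ, 0 < s → s < s₀ → ∀ i j : Fin (N + 1),
      R + 1 ≤ i.val → i.val + 1 + R ≤ N → R + 1 ≤ j.val → j.val + 1 + R ≤ N →
      i.val ≤ j.val + Z → j.val ≤ i.val + Z → |W s i j - K ((i.val : ℤ) - j.val)| ≤ ε)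
    (ρ : ℝ) (hρ : Tendsto (fun s => schur s ((pinnedChain ω₂ lam β γ).bondCurrent N b)
        (fun z => ∑ c : Fin N, (pinnedChain ω₂ lam β γ).bondCurrent N c z)) (nhdsWithin (0 : ℝ) (Set.Ioi 0)) (nhds ρ)) :
    (∑ z ∈ Finset.Icc (-(Z : ℤ)) Z, K z) - (((2 * Z + 1 : ℕ) : ℝ) * ε + τ Z) ≤ ρ := by
  classical
  obtain rfl : lap = fun s f g => ∫ t in Set.Ioi (0 : ℝ), Real.exp (-(s * t)) *
      ((∫ z, f z * (∫ y, g y ∂((pinnedChain ω₂ lam β γ).transitionKernel N T T t.toNNReal z))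
          ∂(pinnedChain ω₂ lam β γ).gibbsMeasure N T) -
        (∫ z, f z ∂(pinnedChain ω₂ lam β γ).gibbsMeasure N T) *
          (∫ z, g z ∂(pinnedChain ω₂ lam β γ).gibbsMeasure N T)) :=
    funext fun s => funext fun f => funext fun g => hlap s f g
  obtain rfl : e = fun x z => z.2 x ^ 2 / 2 + (pinnedChain ω₂ lam β γ).U (z.1 x) +
      ∑ j : Fin N, ((if j.val = x.val + 1 then (pinnedChain ω₂ lam β γ).V (z.1 j - z.1 x) / 2 else 0) +
        (if x.val = j.val + 1 then (pinnedChain ω₂ lam β γ).V (z.1 x - z.1 j) / 2 else 0)) :=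
    funext fun x => funext fun z => he x z
  obtain ⟨-, hFI2, -, -⟩ := stub_feshbachIdentities ω₂ lam β γ hω hl hβ hγ T hT N hN
  refine ge_of_tendsto hρ ?_
  filter_upwards [Ioo_mem_nhdsGT hs₀] with s hs
  -- the response is the bond-column row sum of `W_N(s)` at the position `i = b + 1`
  rw [← bulk_row_sum_pkg (ω₂ := ω₂) (lam := lam) (β := β) (γ := γ) (N := N) (T := T)
    (corr := fun f₁ f₂ t => (∫ z, f₁ z * (∫ y, f₂ y ∂((pinnedChain ω₂ lam β γ).transitionKernel N T T
      t.toNNReal z)) ∂(pinnedChain ω₂ lam β γ).gibbsMeasure N T) -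
      (∫ z, f₁ z ∂(pinnedChain ω₂ lam β γ).gibbsMeasure N T) * (∫ z, f₂ z ∂(pinnedChain ω₂ lam β γ).gibbsMeasure N T))
    (cov := fun f₁ f₂ => (∫ z, f₁ z * f₂ z ∂(pinnedChain ω₂ lam β γ).gibbsMeasure N T) -
      (∫ z, f₁ z ∂(pinnedChain ω₂ lam β γ).gibbsMeasure N T) * (∫ z, f₂ z ∂(pinnedChain ω₂ lam β γ).gibbsMeasure N T))
    (fun f => Iff.rfl) (fun f g t => rfl) (fun s f g => rfl) (fun x z => rfl) hFI2 hω hl.le hβ.le hT g hg hs.1.le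
    (G s) (schur s) (hschur s) (W s) (hW s) i b hib (by omega), ← ohm2_bond_indicator_sum]
  -- two-sided window bookkeeping (`ohm_row_abs_le`), lower half
  have hrow := ohm_row_abs_le i hi1 hi2 (W s i) K ε (τ Z)
    (fun j => hLi s hs.1 hs.2 i j (by omega) (by omega)) (hBi s hs.1 hs.2 i Z)
  have h2 := (abs_sub_le_iff.1 hrow).2
  linarith

/-! ### The link theorem -/

/-- **LINK: the block inputs (U′), (L) and the residue (Q1) at `θ = 0` imply the route's rank-3 crux `PositiveMemory`
as typed** (registered link theorem of line `limit-operator-memory-form`, crux `RobinCoercivity`). Under (U′)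
`BlockBandDomination` (`hU`), (L) `BlockBulkLimit` (`hL`) and (Q1) `BulkSymbolPositivity` (`hQ1`, used only at
`θ = 0` for the bulk limit `K_∞` of (L)): for `pinnedChain ω₂ lam β γ` (all `> 0`) and `T > 0`, with
`k₀ = Σ'_z K_∞(z) / 2 > 0`, there is a bulk depth `R` such that for all `N ≥ 2`, every bond `b` at distance `≥ R` from
both ends and every limit `ρ` of `schur_s(j_b, J)` along `s ↓ 0` (the route decl's own `let`-gadgets), `k₀ ≤ ρ`. -/
theorem positiveMemory_of_blockInputs (hU : BlockBandDomination) (hL : BlockBulkLimit) (hQ1 : BulkSymbolPositivity) :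
    PositiveMemory := by
  unfold BlockBandDomination at hU
  unfold BlockBulkLimit at hL
  unfold BulkSymbolPositivity at hQ1
  intro ω₂ lam β γ hω hl hβ hγ T hT
  obtain ⟨τ, hτ, hUN⟩ := hU ω₂ lam β γ hω hl hβ hγ T hT
  obtain ⟨K, hKs, hLN⟩ := hL ω₂ lam β γ hω hl hβ hγ T hT
  -- (Q1) at `θ = 0` for the bulk limit `K` of (L): `0 < κ := Σ' K`
  have hκ := hQ1 ω₂ lam β γ hω hl hβ hγ T hT K hKs hLN 0
  simp only [mul_zero, Real.cos_zero, mul_one] at hκ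
  set κ : ℝ := ∑' z : ℤ, K z
  -- the window `Z`: symmetric partial sum `κ/6`-close to `κ` and band tail `τ Z < κ/6`
  have h1 : ∀ᶠ Z : ℕ in atTop, dist (∑ z ∈ Finset.Icc (-(Z : ℤ)) Z, K z) κ < κ / 6 :=
    Metric.tendsto_nhds.1 (tendsto_sum_Icc_symm K hKs) (κ / 6) (div_pos hκ (by norm_num))
  have h2 : ∀ᶠ Z : ℕ in atTop, dist (τ Z) 0 < κ / 6 := Metric.tendsto_nhds.1 hτ (κ / 6) (div_pos hκ (by norm_num))
  obtain ⟨Z, hZ1, hZ2⟩ := (h1.and h2).exists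
  rw [Real.dist_eq] at hZ1
  rw [Real.dist_eq, sub_zero] at hZ2
  have hcpos : (0 : ℝ) < ((2 * Z + 1 : ℕ) : ℝ) := by positivity
  -- the bulk depth of (L) at accuracy `κ / (6(2Z+1))` and distance `Z`
  obtain ⟨R, hR⟩ := hLN (κ / (6 * ((2 * Z + 1 : ℕ) : ℝ))) (div_pos hκ (by positivity)) Z
  refine ⟨κ / 2, half_pos hκ, R + Z, fun N hN => ?_⟩
  obtain ⟨s₁, hs₁, hB⟩ := hUN N hN
  obtain ⟨s₂, hs₂, hC⟩ := hR N hN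
  intro P X μ corr lap e G schur J b hb1 hb2 ρ hρ
  -- the fixed-`N` lower bound at the position `i = b + 1`, over the route decl's own gadgets
  have hlow := pm_bulk_row_lower hω hl hβ hγ hT hN lap e G schur _ _ (fun _ _ _ => rfl) (fun _ _ => rfl)
    (fun _ => rfl) (fun _ _ _ => rfl) (fun _ _ => rfl) (fun _ _ _ => rfl) K (κ / (6 * ((2 * Z + 1 : ℕ) : ℝ)))
    (min s₁ s₂) (lt_min hs₁ hs₂) τ Z R ⟨b.val + 1, Nat.succ_lt_succ b.isLt⟩ b rfl
    (by show R + 1 + Z ≤ b.val + 1; omega) (by show b.val + 1 + 1 + R + Z ≤ N; omega)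
    (fun s hs hss => hB lap e G schur _ _ (fun _ _ _ => rfl) (fun _ _ => rfl) (fun _ => rfl) (fun _ _ _ => rfl)
      (fun _ _ => rfl) (fun _ _ _ => rfl) s hs (lt_of_lt_of_le hss (min_le_left _ _)))
    (fun s hs hss => hC lap e G schur _ _ (fun _ _ _ => rfl) (fun _ _ => rfl) (fun _ => rfl) (fun _ _ _ => rfl)
      (fun _ _ => rfl) (fun _ _ _ => rfl) s hs (lt_of_lt_of_le hss (min_le_right _ _)))
    ρ hρ
  have h3 : ((2 * Z + 1 : ℕ) : ℝ) * (κ / (6 * ((2 * Z + 1 : ℕ) : ℝ))) = κ / 6 := by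
    field_simp
  rw [h3] at hlow
  have h4 := (abs_sub_lt_iff.1 hZ1).2
  have h5 : τ Z < κ / 6 := (le_abs_self _).trans_lt hZ2
  linarith

end Summit.AtomisticToContinuum.FouriersLaw.Theorems.HonestZwanzig.Robin

end
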